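import Literature.NumberTheory.GaloisRepresentations.ArtinLFunction
import Literature.NumberTheory.GaloisRepresentations.ModNCyclotomicCharacter
import Literature.NumberTheory.EllipticCurves.ZpExtension
import Literature.NumberTheory.EllipticCurves.CuspFormLFunction
import HarnessLib

/-!
# Finite-order characters of the `ℤ_p²`-extension of an imaginary quadratic field and the
# `L`-function `L(f ⊗ K, 𝒲, s)` of a weight-two form twisted by them (Nekovář 1995, (0.5), §3)

Trunk T-NT-EC (Literature/NumberTheory/EllipticCurves). Vocabulary for the interpolation property
of the two-variable `p`-adic `L`-function of `f` over `K` (definition request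
`defn-twoVariablePAdicLFunctionK`, file `TwoVariablePAdicLFunctionK.lean`), following
J. Nekovář, *On the `p`-adic height of Heegner cycles*, Math. Ann. 302 (1995), 609–686, (0.5)
(p. 611) and §3.3–3.4 (for weight `2` this is Perrin-Riou, J. London Math. Soc. 38 (1988)).

**The printed objects** (Nekovář 1995, (0.5), p. 611). "`L(f, s) = ∑ a_n n^{-s} =
∏_ℓ [(1 - α_ℓ ℓ^{-s})(1 - β_ℓ ℓ^{-s})]⁻¹` (with `α_ℓ β_ℓ = 0` for `ℓ ∣ N`) … Suppose that
`𝒲 : G(K(𝔣)/K) → ℚ̄^*` is a ray class character with conductor `𝔣`. We view `𝒲` as a character on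
ideals prime to `𝔣`, via the reciprocity map (normalized in the old-fashioned way, using
arithmetic Frobenius elements). The `L`-function of `f` over `K`, twisted by `𝒲`, is given by
`L(f ⊗ K, 𝒲, s) = ∏_λ [(1 - α_{N(λ)} 𝒲(λ) N(λ)^{-s})(1 - β_{N(λ)} 𝒲(λ) N(λ)^{-s})]⁻¹`, where `λ`
runs through prime ideals of `𝒪_K` prime to `𝔣` and `α_{N(λ)} = α_ℓ^k`, `β_{N(λ)} = β_ℓ^k` if
`N(λ) = ℓ^k`" (in §3.4: "`𝒲` is extended by zero to ideals that are not prime to `𝔣`"); §3.3: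
`Λ(𝒲, s) := Δ(𝒲)^{s/2} (2π)^{-s} Γ(s) L(𝒲, s) = τ(𝒲) Λ(𝒲̄, 1 - s)`, `Δ(𝒲) = |D| N(𝔣)`, with
`τ(𝒲) ∈ ℚ̄^*`, `|τ(𝒲)| = 1` (the root number); and `K_∞/K` is "the unique `ℤ_p²`-extension of
`K`", whose finite-order characters are the `𝒲` at which the `p`-adic `L`-function is evaluated.

**How they are typed here (tree vocabulary reused; nothing duplicated).** A finite-order
character of `Γ_K` is a continuous `χ : Γ_K →ₜ* ℂˣ`; the tree turns it into a rank-one framed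
Artin representation `FramedRep.ofCharacter χ` (`ModNCyclotomicCharacter.lean`), whose Euler
factor `ArtinRep.eulerFactorAt` (`ArtinLFunction.lean`) at a finite place `v` is `1 - χ(Frob_v) T`
if `χ` is unramified at `v` and `1` otherwise (arithmetic Frobenius;
`FramedArtinRep.eval_eulerFactorAt_of_isUnramifiedAt`,
`FramedArtinRep.eulerFactorAt_eq_one_of_not_isUnramifiedAt` in `ArtinReciprocityCharacter.lean`),
whose conductor is `GaloisRep.artinConductor` (`ArtinConductor.lean`) and whose completed
`L`-function is `completedArtinLFunction` (`A(χ)^{s/2} Γ_ℂ(s) L(χ, s)`, `A(χ) = |d_K| N𝔣(χ) =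
Δ(𝒲)`; `Γ_ℂ(s) = 2 (2π)^{-s} Γ(s)` differs from Nekovář's archimedean factor by the constant `2`,
which cancels in the functional equation). Hence:

* `heckeValueAt χ v = -[T¹] L_v(χ, T)` is the printed "`𝒲(λ)`, extended by zero"; `heckeIdealValue`
  its multiplicative extension to ideals (`𝒲(N)`, `𝒲((√D))` of (0.5));
* `IsArtinRootNumber χ τ` / `artinRootNumber χ` — the printed `τ(𝒲)`, characterised by the
  functional equation `Λ(𝒲, s) = τ(𝒲) Λ(𝒲̄, 1 - s)` of the continuations (a `∃!`-choice; `0` if the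
  functional equation were to fail, which by Hecke's theorem it does not);
* `rankinSelbergEulerProduct f χ s` — the printed Euler product `L(f ⊗ K, 𝒲, s)` for
  `f ∈ S_2(Γ₀(N))` (absolutely convergent for `re s > 3/2`), written WITHOUT choosing `α_ℓ, β_ℓ`:
  `(1 - α^k w X)(1 - β^k w X) = 1 - (α^k + β^k) w X + (αβ)^k w² X²` with `α + β = a_ℓ` (tree
  `cuspCoeff f ℓ`), `αβ = ℓ · 𝟙_{ℓ ∤ N}` and the power sums `α^k + β^k` given by Newton's recursion
  (`frobTracePow`); `IsRankinSelbergValue` / `rankinSelbergValue f χ s₀` — its value at `s₀` through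
  the (entire) continuation (a `∃!`-choice);
* the characters of `G(K_∞/K) = Gal(K_∞^{ac}/K) × Gal(K_∞^{cyc}/K)`: `antiCycCharacter κ n e`,
  `σ ↦ e(κ(σ) mod p^n)` for the anticyclotomic `ℤ_p`-extension `κ : Γ_K ↠ ℤ_p` (tree `ZpExtension`)
  and an additive character `e` of `ℤ/p^n` (so `η(γ) = e(1)` at the topological generator
  `κ(γ) = 1`, `antiCycCharacter_apply_of_isTopGenerator`), and the cyclotomic ones
  `dirichletGaloisCharacter K ψ = ψ ∘ χ_{p^m}` (tree) for `ψ` a Dirichlet character mod `p^m` of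
  `p`-power order (`ψ(Frob_λ) = ψ(N λ)`: the printed "`α ∘ N`", Nekovář (3.2.1)); their product
  `cycAntiCharacter κ ψ e`.

All definitions have bodies; the two `∃!`-choices return `0` off the classical theorems (Hecke's
functional equation; Rankin's continuation), exactly like the tree's `unitRoot`. No statement is
asserted in this file.

## References

* J. Nekovář, *On the `p`-adic height of Heegner cycles*, Math. Ann. 302 (1995), 609–686 (held:
  `paper:doi-10-1007-bf01444511`; page images of pp. 609–612 checked): (0.5) p. 611, §3.2 (3.2.1),
  §3.3 (theta series, `Λ(𝒲, s)`, `τ(𝒲)`), §3.4 (`L(f ⊗ K, 𝒲, s)`).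
* B. Perrin-Riou, *Fonctions `L` `p`-adiques associées à une forme modulaire et à un corps
  quadratique imaginaire*, J. London Math. Soc. (2) 38 (1988), 1–32 (the weight-two case).
* J. Neukirch, *Algebraic Number Theory*, VII §10 (abelian Artin `L`-functions are Hecke
  `L`-series; arithmetic Frobenius), VII §12 (functional equation).
-/

noncomputable section

open scoped MatrixGroups ModularForm
open CongruenceSubgroup NumberField IsDedekindDomain Field
open Literature.NumberTheory.GaloisRepresentations
open Literature.NumberTheory.EllipticCurves.ModularForms

namespace Literature.NumberTheory.EllipticCurves

universe u

/-! ### Values on ideals of a finite-order character of `Γ_K`, "extended by zero" -/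

section HeckeValues

variable {K : Type u} [Field K] [NumberField K]

/-- **The value `𝒲(λ)` of a finite-order character of `Γ_K` at a finite prime `λ`, extended by
zero** (Nekovář 1995, (0.5) and §3.4: "`𝒲` as a character on ideals … using arithmetic Frobenius
elements", "extended by zero to ideals that are not prime to `𝔣`"): minus the linear coefficient
of the Euler factor `L_λ(χ, T)` of the rank-one Artin representation `FramedRep.ofCharacter χ`,
which is `1 - χ(Frob_λ) T` if `χ` is unramified at `λ` and `1` otherwise (Neukirch VII §10, proof
of (10.6); tree `FramedArtinRep.eval_eulerFactorAt_of_isUnramifiedAt`,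
`FramedArtinRep.eulerFactorAt_eq_one_of_not_isUnramifiedAt`). [cite: Nekovar1995, (0.5) p. 611 and §3.4] -/
def heckeValueAt (χ : absoluteGaloisGroup K →ₜ* ℂˣ) (v : HeightOneSpectrum (𝓞 K)) : ℂ :=
  -(ArtinRep.eulerFactorAt (FramedArtinRep.toArtinRep (FramedRep.ofCharacter χ)) v).coeff 1

open scoped Classical in
/-- **`𝒲(𝔞)` for a nonzero ideal `𝔞 = ∏ λ^{e_λ}` of `𝒪_K`**: `∏ 𝒲(λ)^{e_λ}` (multiplicative
extension of `heckeValueAt`, so `0` as soon as a ramified prime divides `𝔞`; `0` for the zero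
ideal). Used for the printed `𝒲(N)` (`𝔞 = (N)`) and `𝒲̄((√D))` of Nekovář 1995, (0.5).
[cite: Nekovar1995, (0.5) p. 611] -/
def heckeIdealValue (χ : absoluteGaloisGroup K →ₜ* ℂˣ) (I : Ideal (𝓞 K)) : ℂ :=
  if I = ⊥ then 0 else
    ∏ᶠ v : HeightOneSpectrum (𝓞 K),
      heckeValueAt χ v ^ (UniqueFactorizationMonoid.normalizedFactors I).count v.asIdeal

/-- The numerical conductor `N(𝔣(𝒲)) ∈ ℕ` of a finite-order character of `Γ_K`: the norm of the
Artin conductor of `FramedRep.ofCharacter χ` (tree `GaloisRep.artinConductorNat`; for a character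
the Artin conductor is the conductor of the corresponding ray class character,
conductor–discriminant formula, Neukirch VII (11.9)). [cite: NeukirchANT1999, Ch. VII (11.9)] -/
abbrev charConductorNat (χ : absoluteGaloisGroup K →ₜ* ℂˣ) : ℕ :=
  GaloisRep.artinConductorNat (FramedArtinRep.toArtinRep (FramedRep.ofCharacter χ))

end HeckeValues

/-! ### The root number `τ(𝒲)` -/

section RootNumber

variable {K : Type u} [Field K] [NumberField K]

/-- **`τ` is the root number of the finite-order character `χ` of `Γ_K`** (Nekovář 1995, §3.3:
"`Λ(𝒲, s) := Δ(𝒲)^{s/2} (2π)^{-s} Γ(s) L(𝒲, s) = τ(𝒲) Λ(𝒲̄, 1 - s)` with `τ(𝒲) ∈ ℚ̄^*`,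
`|τ(𝒲)| = 1`"; Neukirch VII (12.6) in the tree's form `completedArtinLFunction`, whose archimedean
factor `Γ_ℂ(s) = 2(2π)^{-s}Γ(s)` differs from Nekovář's by the constant `2` on both sides): for ALL
continuations `Λ` of `Λ(χ, s)` and `Λ'` of `Λ(χ⁻¹, s)` (holomorphic off `{0, 1}`, agreeing with the
Euler products for `re s > 1`), `Λ(s) = τ · Λ'(1 - s)` off `{0, 1}`. (For `χ = 1` both sides are the
completed Dedekind zeta function and `τ = 1`.) [cite: Nekovar1995, §3.3] -/
def IsArtinRootNumber (χ : absoluteGaloisGroup K →ₜ* ℂˣ) (τ : ℂ) : Prop :=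
  ∀ Λ Λ' : ℂ → ℂ,
    DifferentiableOn ℂ Λ {s : ℂ | s ≠ 0 ∧ s ≠ 1} → DifferentiableOn ℂ Λ' {s : ℂ | s ≠ 0 ∧ s ≠ 1} →
    (∀ s : ℂ, 1 < s.re →
      Λ s = completedArtinLFunction (FramedArtinRep.toArtinRep (FramedRep.ofCharacter χ)) s) →
    (∀ s : ℂ, 1 < s.re →
      Λ' s = completedArtinLFunction (FramedArtinRep.toArtinRep (FramedRep.ofCharacter χ⁻¹)) s) →
    ∀ s : ℂ, s ≠ 0 → s ≠ 1 → Λ s = τ * Λ' (1 - s)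

open scoped Classical in
/-- **The root number `τ(𝒲)`** of a finite-order character of `Γ_K`: the unique `τ` with
`IsArtinRootNumber χ τ` (Hecke's functional equation, Nekovář 1995, §3.3; Neukirch VII (12.6)),
junk `0` if there is no unique such `τ` (which does not happen: continuations exist and are
non-zero). [cite: Nekovar1995, §3.3] -/
def artinRootNumber (χ : absoluteGaloisGroup K →ₜ* ℂˣ) : ℂ :=
  if h : ∃! τ : ℂ, IsArtinRootNumber χ τ then h.choose else 0

/-- Defining property of `artinRootNumber` when the root number is uniquely determined.
[cite: Nekovar1995, §3.3] -/
theorem isArtinRootNumber_artinRootNumber {χ : absoluteGaloisGroup K →ₜ* ℂˣ}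
    (h : ∃! τ : ℂ, IsArtinRootNumber χ τ) : IsArtinRootNumber χ (artinRootNumber χ) := by
  rw [artinRootNumber, dif_pos h]
  exact h.choose_spec.1

end RootNumber

/-! ### The Euler product `L(f ⊗ K, 𝒲, s)` for `f ∈ S_2(Γ₀(N))` -/

section RankinSelberg

variable {K : Type u} [Field K] [NumberField K] {N : ℕ}

/-- **Power sums of the Frobenius roots without choosing them**: for `α + β = a`, `αβ = e`,
`frobTracePow a e k = α^k + β^k` (Newton: `t₀ = 2`, `t₁ = a`, `t_{k+2} = a t_{k+1} - e t_k`).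
[folklore] -/
def frobTracePow (a e : ℂ) : ℕ → ℂ
  | 0 => 2
  | 1 => a
  | k + 2 => a * frobTracePow a e (k + 1) - e * frobTracePow a e k

/-- `frobTracePow a e 0 = 2`. [folklore] -/
@[simp] theorem frobTracePow_zero (a e : ℂ) : frobTracePow a e 0 = 2 := rfl

/-- `frobTracePow a e 1 = a`. [folklore] -/
@[simp] theorem frobTracePow_one (a e : ℂ) : frobTracePow a e 1 = a := rfl

/-- `frobTracePow a e 2 = a² - 2e` (the trace of `Frob²`, used at inert primes). [folklore] -/
theorem frobTracePow_two (a e : ℂ) : frobTracePow a e 2 = a ^ 2 - 2 * e := by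
  simp [frobTracePow]; ring

/-- If `α + β = a` and `αβ = e` then `frobTracePow a e k = α^k + β^k`. [folklore] -/
theorem frobTracePow_eq_pow_add_pow {a e α β : ℂ} (hadd : α + β = a) (hmul : α * β = e) :
    ∀ k : ℕ, frobTracePow a e k = α ^ k + β ^ k
  | 0 => by simp; norm_num
  | 1 => by simp [hadd]
  | k + 2 => by
    rw [frobTracePow, frobTracePow_eq_pow_add_pow hadd hmul (k + 1),
      frobTracePow_eq_pow_add_pow hadd hmul k, ← hadd, ← hmul]
    ring

/-- **The inverse local factor of `L(f ⊗ K, 𝒲, s)` at the finite prime `λ` of `K`** (Nekovář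
1995, (0.5)/(3.4)): with `N(λ) = ℓ^k`, `w = 𝒲(λ)` (extended by zero), `X = N(λ)^{-s}`,
`(1 - α_ℓ^k w X)(1 - β_ℓ^k w X) = 1 - (α_ℓ^k + β_ℓ^k) w X + (α_ℓ β_ℓ)^k w² X²`, where
`α_ℓ + β_ℓ = a_ℓ(f)` (`cuspCoeff f ℓ`) and `α_ℓ β_ℓ = ℓ` for `ℓ ∤ N`, `= 0` for `ℓ ∣ N`
("`α_ℓ β_ℓ = 0` for `ℓ ∣ N`"; `L(f, s) = ∏ (1 - a_ℓ ℓ^{-s} + 𝟙_{ℓ∤N} ℓ^{1-2s})⁻¹` in weight `2`,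
trivial character, Nekovář (3.4)). [cite: Nekovar1995, (0.5) p. 611 and §3.4] -/
def rankinSelbergLocalFactorInv (f : CuspForm (Gamma0 N) 2) (χ : absoluteGaloisGroup K →ₜ* ℂˣ)
    (v : HeightOneSpectrum (𝓞 K)) (s : ℂ) : ℂ :=
  let q : ℕ := Ideal.absNorm v.asIdeal
  let ℓ : ℕ := q.minFac
  let k : ℕ := q.factorization ℓ
  let e : ℂ := if ℓ ∣ N then 0 else ℓ
  let w : ℂ := heckeValueAt χ v
  1 - frobTracePow (cuspCoeff f ℓ) e k * w * (q : ℂ) ^ (-s) + e ^ k * w ^ 2 * (q : ℂ) ^ (-2 * s)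

/-- **`L(f ⊗ K, 𝒲, s)` as printed**: the Euler product over the finite primes of `K` (the
factors at the primes dividing the conductor are `1` because `𝒲` is extended by zero there),
a `tprod`, absolutely convergent for `re s > 3/2` (Ramanujan bound `|α_ℓ| = |β_ℓ| = √ℓ`); junk
elsewhere — its continuation is handled by `IsRankinSelbergValue`. For `𝒲 = 1` this is
`L(f, s) L(f ⊗ (D/·), s)` (Nekovář (3.4); tree `analyticRankEK` convention), and in general it is
the Rankin–Selberg convolution `D(f, Θ(𝒲), s)` of `f` with the weight-one theta series of `𝒲`
(Nekovář (3.4), (1.7.1)). [cite: Nekovar1995, (0.5) p. 611 and §3.4] -/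
def rankinSelbergEulerProduct (f : CuspForm (Gamma0 N) 2) (χ : absoluteGaloisGroup K →ₜ* ℂˣ)
    (s : ℂ) : ℂ :=
  ∏' v : HeightOneSpectrum (𝓞 K), (rankinSelbergLocalFactorInv f χ v s)⁻¹

/-- **`L₀` is the value at `s₀` of (the analytic continuation of) `L(f ⊗ K, 𝒲, s)`**: every
entire function agreeing with the Euler product for `re s > 3/2` takes the value `L₀` at `s₀`.
(The continuation exists and is entire — Rankin, Shimura; Nekovář 1995, §1.6–1.7 — and is unique,
so exactly one `L₀` qualifies; were there no continuation, every `L₀` would.) [cite: Nekovar1995, §1.6–1.7 and (0.5)] -/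
def IsRankinSelbergValue (f : CuspForm (Gamma0 N) 2) (χ : absoluteGaloisGroup K →ₜ* ℂˣ)
    (s₀ L₀ : ℂ) : Prop :=
  ∀ L : ℂ → ℂ, Differentiable ℂ L →
    (∀ s : ℂ, 3 / 2 < s.re → L s = rankinSelbergEulerProduct f χ s) → L s₀ = L₀

open scoped Classical in
/-- **The special value `L(f ⊗ K, 𝒲, s₀)`** (through the continuation): the unique `L₀` with
`IsRankinSelbergValue f χ s₀ L₀`, junk `0` if not unique. [cite: Nekovar1995, (0.5) p. 611] -/
def rankinSelbergValue (f : CuspForm (Gamma0 N) 2) (χ : absoluteGaloisGroup K →ₜ* ℂˣ)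
    (s₀ : ℂ) : ℂ :=
  if h : ∃! L₀ : ℂ, IsRankinSelbergValue f χ s₀ L₀ then h.choose else 0

/-- Defining property of `rankinSelbergValue` when the value is uniquely determined.
[cite: Nekovar1995, (0.5) p. 611] -/
theorem isRankinSelbergValue_rankinSelbergValue {f : CuspForm (Gamma0 N) 2}
    {χ : absoluteGaloisGroup K →ₜ* ℂˣ} {s₀ : ℂ} (h : ∃! L₀ : ℂ, IsRankinSelbergValue f χ s₀ L₀) :
    IsRankinSelbergValue f χ s₀ (rankinSelbergValue f χ s₀) := by
  rw [rankinSelbergValue, dif_pos h]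
  exact h.choose_spec.1

/-- Two entire continuations of the Euler product coincide (identity theorem). [folklore] -/
theorem eq_of_isEntireContinuation_rankinSelberg {f : CuspForm (Gamma0 N) 2}
    {χ : absoluteGaloisGroup K →ₜ* ℂˣ} {L L₁ : ℂ → ℂ} (hL : Differentiable ℂ L)
    (hL' : ∀ s : ℂ, 3 / 2 < s.re → L s = rankinSelbergEulerProduct f χ s)
    (hL₁ : Differentiable ℂ L₁)
    (hL₁' : ∀ s : ℂ, 3 / 2 < s.re → L₁ s = rankinSelbergEulerProduct f χ s) : L₁ = L := by
  refine AnalyticOnNhd.eq_of_eventuallyEq (𝕜 := ℂ) (z₀ := 2) (fun z _ ↦ hL₁.analyticAt z)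
    (fun z _ ↦ hL.analyticAt z) ?_
  have hopen : IsOpen {s : ℂ | 3 / 2 < s.re} := isOpen_lt continuous_const Complex.continuous_re
  filter_upwards [hopen.mem_nhds (show (3 : ℝ) / 2 < (2 : ℂ).re by norm_num)] with s hs
  rw [hL₁' s hs, hL' s hs]

/-- If an entire continuation `L` of the Euler product exists, `rankinSelbergValue` is its value.
[cite: Nekovar1995, (0.5) p. 611] -/
theorem rankinSelbergValue_eq {f : CuspForm (Gamma0 N) 2} {χ : absoluteGaloisGroup K →ₜ* ℂˣ}
    {L : ℂ → ℂ} (hL : Differentiable ℂ L)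
    (hL' : ∀ s : ℂ, 3 / 2 < s.re → L s = rankinSelbergEulerProduct f χ s) (s₀ : ℂ) :
    rankinSelbergValue f χ s₀ = L s₀ := by
  have hex : ∃! L₀ : ℂ, IsRankinSelbergValue f χ s₀ L₀ := by
    refine ⟨L s₀, fun L₁ hL₁ hL₁' ↦ ?_, fun L₀ h ↦ (h L hL hL').symm⟩
    rw [eq_of_isEntireContinuation_rankinSelberg hL hL' hL₁ hL₁']
  exact (isRankinSelbergValue_rankinSelbergValue hex L hL hL').symm

end RankinSelberg

/-! ### Finite-order characters of the `ℤ_p²`-extension `K_∞ = K_∞^{ac} K_∞^{cyc}` -/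

section Characters

variable {K : Type u} [Field K] {p : ℕ} [Fact p.Prime]

/-- The anticyclotomic character `σ ↦ e(κ(σ) mod p^n)` as a bare homomorphism `Γ_K →* ℂˣ`
(auxiliary for `antiCycCharacter`). [folklore] -/
def antiCycCharacterHom (κ : ZpExtension K p) (n : ℕ) (e : AddChar (ZMod (p ^ n)) ℂ) :
    absoluteGaloisGroup K →* ℂˣ :=
  e.toMonoidHom.toHomUnits.comp
    ((PadicInt.toZModPow n).toAddMonoidHom.toMultiplicative.comp
      κ.toContinuousMonoidHom.toMonoidHom)

/-- Values of `antiCycCharacterHom`. [folklore] -/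
@[simp] theorem coe_antiCycCharacterHom_apply (κ : ZpExtension K p) (n : ℕ)
    (e : AddChar (ZMod (p ^ n)) ℂ) (σ : absoluteGaloisGroup K) :
    ((antiCycCharacterHom κ n e σ : ℂˣ) : ℂ) = e (PadicInt.toZModPow n (κ σ).toAdd) :=
  rfl

/-- **The finite-order characters of the anticyclotomic `ℤ_p`-extension.** For `κ : Γ_K ↠ ℤ_p`
(tree `ZpExtension`, intended anticyclotomic) and an additive character `e` of `ℤ/p^n`, the
continuous character `η = antiCycCharacter κ n e : Γ_K →ₜ* ℂˣ`, `σ ↦ e(κ(σ) mod p^n)`; it factors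
through `Gal(K_n/K) = Γ_K/κ⁻¹(p^nℤ_p)` and takes the value `e(1)` at a topological generator
(`κ(γ) = 1`). As `e` ranges over the additive characters of `ℤ/p^n` and `n` over `ℕ`, these are
exactly the characters of finite order of `Gal(K_∞^{ac}/K) ≅ ℤ_p` (Nekovář 1995, §3.2: the
characters `η` of `G(H_n/K)` with `η η^τ = 1`, here those factoring through the `ℤ_p`-extension).
Continuity: `η` is constant on the open subgroup `κ⁻¹(p^nℤ_p)` (`ZpExtension.isOpen_layerSubgroup`).
[cite: Nekovar1995, §3.2 (3.2.1)] -/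
def antiCycCharacter (κ : ZpExtension K p) (n : ℕ) (e : AddChar (ZMod (p ^ n)) ℂ) :
    absoluteGaloisGroup K →ₜ* ℂˣ where
  toMonoidHom := antiCycCharacterHom κ n e
  continuous_toFun := by
    refine continuous_of_continuousAt_one (antiCycCharacterHom κ n e) ?_
    rw [ContinuousAt, map_one]
    refine Filter.Tendsto.mono_right ?_ (pure_le_nhds 1)
    rw [Filter.tendsto_pure]
    filter_upwards [(κ.isOpen_layerSubgroup n).mem_nhds (κ.layerSubgroup n).one_mem] with σ hσ
    have hσ' : (κ σ).toAdd ∈ RingHom.ker (PadicInt.toZModPow (p := p) n) := by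
      rw [PadicInt.ker_toZModPow, Ideal.mem_span_singleton]
      exact ZpExtension.mem_layerSubgroup.mp hσ
    ext
    rw [coe_antiCycCharacterHom_apply, (RingHom.mem_ker).mp hσ', AddChar.map_zero_eq_one,
      Units.val_one]

/-- Values of `antiCycCharacter`: `η(σ) = e(κ(σ) mod p^n)`. [folklore] -/
@[simp] theorem coe_antiCycCharacter_apply (κ : ZpExtension K p) (n : ℕ)
    (e : AddChar (ZMod (p ^ n)) ℂ) (σ : absoluteGaloisGroup K) :
    ((antiCycCharacter κ n e σ : ℂˣ) : ℂ) = e (PadicInt.toZModPow n (κ σ).toAdd) :=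
  rfl

/-- **At a topological generator `γ` of `Gal(K_∞^{ac}/K)` (`κ(γ) = 1`) the character takes the
value `e(1)`** — the point `η(γ) - 1 = e(1) - 1` at which the anticyclotomic variable `T = γ - 1`
of `Λ_anti` is evaluated. [folklore] -/
theorem coe_antiCycCharacter_apply_of_isTopGenerator (κ : ZpExtension K p) (n : ℕ)
    (e : AddChar (ZMod (p ^ n)) ℂ) {γ : absoluteGaloisGroup K} (hγ : κ.IsTopGenerator γ) :
    ((antiCycCharacter κ n e γ : ℂˣ) : ℂ) = e 1 := by
  rw [coe_antiCycCharacter_apply, show κ γ = Multiplicative.ofAdd 1 from hγ, toAdd_ofAdd,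
    map_one]

/-- `η` is trivial on `Gal(K̄/K_n) = κ⁻¹(p^n ℤ_p)`: it is a character of the `n`-th layer.
[folklore] -/
theorem antiCycCharacter_eq_one_of_mem_layerSubgroup (κ : ZpExtension K p) (n : ℕ)
    (e : AddChar (ZMod (p ^ n)) ℂ) {σ : absoluteGaloisGroup K} (hσ : σ ∈ κ.layerSubgroup n) :
    antiCycCharacter κ n e σ = 1 := by
  have hσ' : (κ σ).toAdd ∈ RingHom.ker (PadicInt.toZModPow (p := p) n) := by
    rw [PadicInt.ker_toZModPow, Ideal.mem_span_singleton]
    exact ZpExtension.mem_layerSubgroup.mp hσ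
  ext
  rw [coe_antiCycCharacter_apply, (RingHom.mem_ker).mp hσ', AddChar.map_zero_eq_one,
    Units.val_one]

variable [NumberField K]

/-- **The finite-order characters `𝒲 = η · (ψ ∘ χ_cyc)` of the `ℤ_p²`-extension `K_∞/K`**
(Nekovář 1995, §3.2 (3.2.1): every character of `G(K(𝔣) ∩ H_∞(μ_∞)/K)` is a product
`η · (α ∘ N)` of a ring class character and a Dirichlet character composed with the norm): the
product of the anticyclotomic character `antiCycCharacter κ n e` and the cyclotomic character
`dirichletGaloisCharacter K ψ = ψ ∘ χ_{p^m}` (tree; `ψ(Frob_λ) = ψ(N λ)` for `λ ∤ p`,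
`modNCyclotomicCharacter_eq_residueCard_of_isArithFrobAt`) for a Dirichlet character `ψ` modulo
`p^m`; for `ψ` of `p`-power order (trivial on `μ_{p-1}`) the latter factors through
`Gal(K_∞^{cyc}/K) ≅ 1 + pℤ_p`, with value `ψ(1 + p)` at the generator `γ₀ = cyclotomicGenerator p`.
[cite: Nekovar1995, §3.2 (3.2.1)] -/
def cycAntiCharacter (κ : ZpExtension K p) {m : ℕ} (ψ : DirichletCharacter ℂ (p ^ m)) {n : ℕ}
    (e : AddChar (ZMod (p ^ n)) ℂ) : absoluteGaloisGroup K →ₜ* ℂˣ :=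
  haveI : NeZero (p ^ m) := ⟨pow_ne_zero _ (Fact.out : p.Prime).ne_zero⟩
  antiCycCharacter κ n e * dirichletGaloisCharacter K ψ

/-- Values of `cycAntiCharacter`: `𝒲(σ) = e(κ(σ) mod p^n) · ψ(χ_{p^m}(σ))`. [folklore] -/
theorem coe_cycAntiCharacter_apply (κ : ZpExtension K p) {m : ℕ}
    (ψ : DirichletCharacter ℂ (p ^ m)) {n : ℕ} (e : AddChar (ZMod (p ^ n)) ℂ)
    (σ : absoluteGaloisGroup K) :
    haveI : NeZero (p ^ m) := ⟨pow_ne_zero _ (Fact.out : p.Prime).ne_zero⟩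
    ((cycAntiCharacter κ ψ e σ : ℂˣ) : ℂ) =
      e (PadicInt.toZModPow n (κ σ).toAdd) * ψ (modNCyclotomicCharacter K (p ^ m) σ : ZMod (p ^ m)) := by
  rfl

end Characters

end Literature.NumberTheory.EllipticCurves

end
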